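import Summits.Ventures.PercRepro.Night2ShadowFirstLayer

/-!
# PercRepro — THE SHADOW LAYERS OF A FAMILY OF RANK-`u` SETS (p8, S3; part A — the `RLS` consequences and the
large-corank cells of the `q = 6` window are part B, `S3ShadowLayersRLS`)

`proofs/SUBCLAIM-S3-p8.md` §3b. night-2's first-layer e-lemma (`shadowLevel_card_of_notMem_closure`,
Night2ShadowFirstLayer) counts the sets `B ∪ {z}`, `z ∉ cl B`, above a family `𝒜` of bottom sets, with the fibre
bound `card_coloops_le` (a rank-`(u+1)` set has at most `u + 1` coloops); it lower-bounds `#{z ∉ cl B}` by the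
RANK (`p − q`). On the `e`-free core every rank-`u` flat has at most `F u` points, so `#{z ∉ cl B} ≥ n − F u` —
and this is large when the corank is large. Iterating over the levels:

* **`shadowLevel_succ_mul_card_ge`** — for ANY family `𝒜` of rank-`u` sets whose closures have `≤ F` points,
  `(n − F)·#𝒜 ≤ (u + 1)·#shadowLevel M (u + 1) 𝒜`;
* **`layerProd_mul_card_le_shadowLevel`** — iterated: `L_k · #𝒜 ≤ #shadowLevel M (q + k) 𝒜` with
  `L_k = Π_{i<k} (n − F (q + i)) / (q + i + 1)`;
* **`shadowHall_of_layers`** — summing the levels `q < u < p`: `ShadowHall M p q (Σ_{1 ≤ k ≤ p−q−1} L_k)`, hence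
  (`c025_of_shadowHall`) the body of `C025` on `M` whenever `Φ(p, q) ≤ Σ_k L_k` (`rls_of_layers`);
* **`rls_six_of_layers_core`** — at level `6` on the `e`-free core with `F u = 44·2^{u−6} − 1` (`F 6 = 43`,
  PlaneTen; the cover recursion `ncard_le_two_mul_add_one_of_free` above `6`): `Φ(p, 6) ≤ Σ_k L_k ⇒ RLS M p 6`;
  and its first-layer form **`rls_six_of_first_layer_core`**: `7·Φ(p, 6) ≤ n − 43 ⇒ RLS M p 6`.
What this closes in the S3 cell map (numbers in the section): the cells `(p, d)` with `9 ≤ p ≤ 51` and the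
corank `d` large — e.g. `(9, d ≥ 52)`, `(10, d ≥ 65)`, `(11, d ≥ 82)`, `(12, d ≥ 107)` by the first layer alone,
`(20, d ≥ 202)`, `(30, d ≥ 388)`, `(51, d ≥ 1 210)` by all layers with `F u = 2^u − 1`-type bounds — the region
the counting recipe (`c025_core_six_fortythree`, corank `≥ 51` only from `p ≥ 81`) does not reach.
Axioms: standard.
-/

namespace PercRepro.Shadow

open Finset PerFlat ThmH

variable {α : Type*} [DecidableEq α] {M : Matroid α} [M.Finite]

omit [DecidableEq α] in
/-- Membership in `levelSet`. -/
theorem mem_levelSet {u : ℕ} {S : Finset α} :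
    S ∈ levelSet M u ↔ S ⊆ gr M ∧ M.eRk (S : Set α) = (u : ℕ∞) := by
  unfold levelSet
  rw [Finset.mem_filter, Finset.mem_powerset]

/-- Membership in `shadowLevel`. -/
theorem mem_shadowLevel {u : ℕ} {𝒜 : Finset (Finset α)} {S : Finset α} :
    S ∈ shadowLevel M u 𝒜 ↔ S ∈ levelSet M u ∧ ∃ B ∈ 𝒜, B ⊆ S := by
  unfold shadowLevel
  rw [Finset.mem_filter]

/-- `shadowLevel M u 𝒜 ⊆ levelSet M u`. -/
theorem shadowLevel_subset_levelSet (u : ℕ) (𝒜 : Finset (Finset α)) :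
    shadowLevel M u 𝒜 ⊆ levelSet M u := fun _ hS => (mem_shadowLevel.1 hS).1

/-- The shadow of the shadow lies in the shadow: `shadowLevel M v (shadowLevel M u 𝒜) ⊆ shadowLevel M v 𝒜`. -/
theorem shadowLevel_shadowLevel_subset (u v : ℕ) (𝒜 : Finset (Finset α)) :
    shadowLevel M v (shadowLevel M u 𝒜) ⊆ shadowLevel M v 𝒜 := by
  intro S hS
  rw [mem_shadowLevel] at hS ⊢
  obtain ⟨hS, T, hT, hTS⟩ := hS
  obtain ⟨-, B, hB, hBT⟩ := mem_shadowLevel.1 hT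
  exact ⟨hS, B, hB, hBT.trans hTS⟩

/-- A family of rank-`u` sets lies in its own level-`u` shadow. -/
theorem subset_shadowLevel_self {u : ℕ} {𝒜 : Finset (Finset α)} (h𝒜 : 𝒜 ⊆ levelSet M u) :
    𝒜 ⊆ shadowLevel M u 𝒜 := by
  intro B hB
  rw [mem_shadowLevel]
  exact ⟨h𝒜 hB, B, hB, subset_rfl⟩

/-- The bottom sets at `(p, q)` are rank-`q` sets. -/
theorem Uq_subset_levelSet (p q : ℕ) : Uq M p q ⊆ levelSet M q := by
  intro B hB
  rw [mem_Uq] at hB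
  rw [mem_levelSet]
  exact ⟨hB.1, hB.2.1⟩

omit [DecidableEq α] in
/-- A rank-`u` subset of the ground set with `q < u < p` is a middle set. -/
theorem levelSet_subset_Yq {p q u : ℕ} (hqu : q < u) (hup : u < p) : levelSet M u ⊆ Yq M p q := by
  intro S hS
  rw [mem_levelSet] at hS
  unfold Yq
  rw [Finset.mem_filter, Finset.mem_powerset, hS.2]
  exact ⟨hS.1, by exact_mod_cast hqu, by exact_mod_cast hup⟩

/-- Adding an element outside the closure of a rank-`u` set gives a rank-`(u + 1)` set. -/
theorem insert_mem_levelSet_succ {u : ℕ} {B : Finset α} (hB : B ∈ levelSet M u) {e : α} (he : e ∈ gr M)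
    (hcl : e ∉ clF M B) : insert e B ∈ levelSet M (u + 1) := by
  rw [mem_levelSet] at hB ⊢
  obtain ⟨hBg, hBu⟩ := hB
  have heE : e ∈ M.E \ M.closure (B : Set α) := by
    refine ⟨by rw [← coe_gr]; exact_mod_cast he, ?_⟩
    rw [← coe_clF]
    exact_mod_cast hcl
  refine ⟨Finset.insert_subset he hBg, ?_⟩
  rw [Finset.coe_insert, Matroid.eRk_insert_eq_add_one heE, hBu]
  push_cast
  rfl

omit [DecidableEq α] in
/-- An element outside the closure of `B` is outside `B`. -/
theorem notMem_of_notMem_clF' {B : Finset α} (hB : B ⊆ gr M) {e : α} (hcl : e ∉ clF M B) : e ∉ B := by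
  intro heB
  apply hcl
  have : (e : α) ∈ M.closure (B : Set α) :=
    M.subset_closure (B : Set α) (by rw [← coe_gr]; exact_mod_cast hB) (by exact_mod_cast heB)
  rw [← coe_clF] at this
  exact_mod_cast this

/-- **One layer up.** If every member of a family `𝒜` of rank-`u` sets has a closure of at most `F` points,
then `(n − F)·#𝒜 ≤ (u + 1)·#shadowLevel M (u + 1) 𝒜` (`n = #E`): the pairs `(B, z)`, `z ∈ E ∖ cl B`, number at
least `(n − F)·#𝒜`, their sets `B ∪ {z}` have rank `u + 1`, and a rank-`(u + 1)` set is `B ∪ {z}` for at most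
`u + 1` pairs (`z` must be a coloop of it). -/
theorem shadowLevel_succ_mul_card_ge (u F : ℕ) (𝒜 : Finset (Finset α)) (h𝒜 : 𝒜 ⊆ levelSet M u)
    (hF : ∀ B ∈ 𝒜, (clF M B).card ≤ F) :
    ((gr M).card - F) * 𝒜.card ≤ (u + 1) * (shadowLevel M (u + 1) 𝒜).card := by
  classical
  set P : Finset (Σ _ : Finset α, α) := 𝒜.sigma (fun B => gr M \ clF M B) with hP
  let f : (Σ _ : Finset α, α) → Finset α := fun x => insert x.2 x.1
  have hmemP : ∀ x ∈ P, x.1 ∈ 𝒜 ∧ x.2 ∈ gr M ∧ x.2 ∉ clF M x.1 := by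
    intro x hx
    rw [hP, Finset.mem_sigma, Finset.mem_sdiff] at hx
    exact ⟨hx.1, hx.2.1, hx.2.2⟩
  have hclg : ∀ B ∈ 𝒜, clF M B ⊆ gr M := by
    intro B _
    rw [← Finset.coe_subset, coe_clF, coe_gr]
    exact M.closure_subset_ground _
  have hPcard : ((gr M).card - F) * 𝒜.card ≤ P.card := by
    rw [hP, Finset.card_sigma]
    calc ((gr M).card - F) * 𝒜.card = ∑ _B ∈ 𝒜, ((gr M).card - F) := by simp [mul_comm]
      _ ≤ ∑ B ∈ 𝒜, (gr M \ clF M B).card := by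
          apply Finset.sum_le_sum
          intro B hB
          have hinter : clF M B ∩ gr M = clF M B := Finset.inter_eq_left.2 (hclg B hB)
          rw [Finset.card_sdiff, hinter]
          have := hF B hB
          omega
  have himg : P.image f ⊆ shadowLevel M (u + 1) 𝒜 := by
    intro S hS
    rw [Finset.mem_image] at hS
    obtain ⟨x, hx, rfl⟩ := hS
    obtain ⟨hx1, hx2, hx3⟩ := hmemP x hx
    rw [mem_shadowLevel]
    exact ⟨insert_mem_levelSet_succ (h𝒜 hx1) hx2 hx3, x.1, hx1, Finset.subset_insert _ _⟩
  have hfib : P.card ≤ (u + 1) * (P.image f).card := by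
    apply Finset.card_le_mul_card_image
    intro S hS
    rw [Finset.mem_image] at hS
    obtain ⟨x0, hx0, rfl⟩ := hS
    obtain ⟨hx01, hx02, hx03⟩ := hmemP x0 hx0
    have hx0g : x0.1 ⊆ gr M := (mem_levelSet.1 (h𝒜 hx01)).1
    have hSg : f x0 ⊆ gr M := Finset.insert_subset hx02 hx0g
    have hSr : M.eRk ((f x0 : Finset α) : Set α) = ((u + 1 : ℕ) : ℕ∞) :=
      (mem_levelSet.1 (insert_mem_levelSet_succ (h𝒜 hx01) hx02 hx03)).2
    have hinj : ((P.filter (fun x => f x = f x0)).card) ≤ (coloops M (f x0)).card := by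
      apply Finset.card_le_card_of_injOn (fun x => x.2)
      · intro x hx
        rw [Finset.coe_filter] at hx
        obtain ⟨hxP, hxf⟩ := hx
        obtain ⟨hx1, -, hx3⟩ := hmemP x hxP
        have hzx : x.2 ∉ x.1 := notMem_of_notMem_clF' (mem_levelSet.1 (h𝒜 hx1)).1 hx3
        rw [Finset.mem_coe, mem_coloops]
        refine ⟨?_, ?_⟩
        · rw [← hxf]; exact Finset.mem_insert_self _ _
        · have : (f x0).erase x.2 = x.1 := by
            rw [← hxf]
            exact Finset.erase_insert hzx
          rw [this]
          exact hx3
      · intro x hx y hy hxy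
        rw [Finset.coe_filter] at hx hy
        obtain ⟨hxP, hxf⟩ := hx
        obtain ⟨hyP, hyf⟩ := hy
        obtain ⟨hx1, -, hx3⟩ := hmemP x hxP
        obtain ⟨hy1, -, hy3⟩ := hmemP y hyP
        have hzx : x.2 ∉ x.1 := notMem_of_notMem_clF' (mem_levelSet.1 (h𝒜 hx1)).1 hx3
        have hzy : y.2 ∉ y.1 := notMem_of_notMem_clF' (mem_levelSet.1 (h𝒜 hy1)).1 hy3
        have hx' : x.1 = (f x0).erase x.2 := by rw [← hxf]; exact (Finset.erase_insert hzx).symm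
        have hy' : y.1 = (f x0).erase y.2 := by rw [← hyf]; exact (Finset.erase_insert hzy).symm
        have hxy' : x.2 = y.2 := hxy
        have h1 : x.1 = y.1 := by rw [hx', hy', hxy']
        exact Sigma.ext h1 (heq_of_eq hxy')
    calc ((P.filter (fun x => f x = f x0)).card) ≤ (coloops M (f x0)).card := hinj
      _ ≤ u + 1 := card_coloops_le hSg hSr
  calc ((gr M).card - F) * 𝒜.card ≤ P.card := hPcard
    _ ≤ (u + 1) * (P.image f).card := hfib
    _ ≤ (u + 1) * (shadowLevel M (u + 1) 𝒜).card := Nat.mul_le_mul_left _ (Finset.card_le_card himg)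

/-- The layer product `L_k = Π_{i<k} (n − F (q + i)) / (q + i + 1)` (in `ℚ`). -/
def layerProd (n q : ℕ) (F : ℕ → ℕ) : ℕ → ℚ
  | 0 => 1
  | k + 1 => layerProd n q F k * (((n - F (q + k) : ℕ) : ℚ) / ((q + k : ℚ) + 1))

/-- `L_k ≥ 0`. -/
theorem layerProd_nonneg (n q : ℕ) (F : ℕ → ℕ) (k : ℕ) : 0 ≤ layerProd n q F k := by
  induction k with
  | zero => simp [layerProd]
  | succ k ih =>
    simp only [layerProd]
    positivity

/-- **The iterated layers.** If every rank-`(q + i)` subset of the ground set has at most `F (q + i)` points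
(for the `i < k` in play) and `𝒜` is a family of rank-`q` sets, then `L_k · #𝒜 ≤ #shadowLevel M (q + k) 𝒜`. -/
theorem layerProd_mul_card_le_shadowLevel (q : ℕ) (F : ℕ → ℕ)
    (hF : ∀ u : ℕ, ∀ X ⊆ gr M, M.eRk (X : Set α) ≤ (u : ℕ∞) → X.card ≤ F u)
    (𝒜 : Finset (Finset α)) (h𝒜 : 𝒜 ⊆ levelSet M q) (k : ℕ) :
    layerProd (gr M).card q F k * (𝒜.card : ℚ) ≤ ((shadowLevel M (q + k) 𝒜).card : ℚ) := by
  induction k with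
  | zero =>
    simp only [layerProd, one_mul, Nat.add_zero]
    exact_mod_cast Finset.card_le_card (subset_shadowLevel_self h𝒜)
  | succ k ih =>
    -- one layer up from `𝒜_k := shadowLevel M (q + k) 𝒜`
    set 𝒜k := shadowLevel M (q + k) 𝒜 with h𝒜k
    have h𝒜kl : 𝒜k ⊆ levelSet M (q + k) := shadowLevel_subset_levelSet _ _
    have hFk : ∀ B ∈ 𝒜k, (clF M B).card ≤ F (q + k) := by
      intro B hB
      have hBl := mem_levelSet.1 (h𝒜kl hB)
      apply hF (q + k)
      · rw [← Finset.coe_subset, coe_clF, coe_gr]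
        exact M.closure_subset_ground _
      · rw [coe_clF, M.eRk_closure_eq, hBl.2]
    have h1 := shadowLevel_succ_mul_card_ge (q + k) (F (q + k)) 𝒜k h𝒜kl hFk
    have h2 : shadowLevel M (q + k + 1) 𝒜k ⊆ shadowLevel M (q + k + 1) 𝒜 :=
      shadowLevel_shadowLevel_subset _ _ _
    have h3 : (shadowLevel M (q + k + 1) 𝒜k).card ≤ (shadowLevel M (q + k + 1) 𝒜).card :=
      Finset.card_le_card h2
    have h1q : (((gr M).card - F (q + k) : ℕ) : ℚ) * (𝒜k.card : ℚ) ≤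
        ((q + k : ℚ) + 1) * ((shadowLevel M (q + k + 1) 𝒜).card : ℚ) := by
      have : (((gr M).card - F (q + k) : ℕ) : ℚ) * (𝒜k.card : ℚ) ≤
          (((q + k + 1) * (shadowLevel M (q + k + 1) 𝒜k).card : ℕ) : ℚ) := by exact_mod_cast h1
      have h3' : (((q + k + 1) * (shadowLevel M (q + k + 1) 𝒜k).card : ℕ) : ℚ) ≤
          (((q + k + 1) * (shadowLevel M (q + k + 1) 𝒜).card : ℕ) : ℚ) := by
        exact_mod_cast Nat.mul_le_mul_left _ h3
      have := this.trans h3'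
      push_cast at this
      linarith
    have hpos : (0 : ℚ) < (q + k : ℚ) + 1 := by positivity
    have hL0 := layerProd_nonneg (gr M).card q F k
    simp only [layerProd]
    rw [show q + (k + 1) = q + k + 1 by ring]
    calc layerProd (gr M).card q F k * ((((gr M).card - F (q + k) : ℕ) : ℚ) / ((q + k : ℚ) + 1)) * (𝒜.card : ℚ)
        = (layerProd (gr M).card q F k * (𝒜.card : ℚ)) * ((((gr M).card - F (q + k) : ℕ) : ℚ) / ((q + k : ℚ) + 1)) := by
          ring
      _ ≤ ((𝒜k.card : ℚ)) * ((((gr M).card - F (q + k) : ℕ) : ℚ) / ((q + k : ℚ) + 1)) := by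
          apply mul_le_mul_of_nonneg_right ih
          positivity
      _ = ((((gr M).card - F (q + k) : ℕ) : ℚ) * (𝒜k.card : ℚ)) / ((q + k : ℚ) + 1) := by ring
      _ ≤ ((shadowLevel M (q + k + 1) 𝒜).card : ℚ) := by
          rw [div_le_iff₀ hpos]
          linarith

/-- The level shadows `q < u < p` are pairwise disjoint subsets of the shadow, so their cards add up. -/
theorem sum_shadowLevel_card_le_shadow (p q : ℕ) (𝒜 : Finset (Finset α)) :
    ∑ u ∈ Finset.Ioo q p, (shadowLevel M u 𝒜).card ≤ (shadow M p q 𝒜).card := by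
  classical
  rw [← Finset.card_biUnion]
  · apply Finset.card_le_card
    intro S hS
    rw [Finset.mem_biUnion] at hS
    obtain ⟨u, hu, hS⟩ := hS
    rw [Finset.mem_Ioo] at hu
    rw [mem_shadowLevel] at hS
    rw [mem_shadow]
    exact ⟨levelSet_subset_Yq hu.1 hu.2 hS.1, hS.2⟩
  · intro u _ v _ huv
    rw [Function.onFun, Finset.disjoint_left]
    intro S hSu hSv
    have h1 := (mem_levelSet.1 (mem_shadowLevel.1 hSu).1).2
    have h2 := (mem_levelSet.1 (mem_shadowLevel.1 hSv).1).2
    rw [h1] at h2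
    exact huv (by exact_mod_cast h2)

/-- **The shadow Hall condition from the layers**: `ShadowHall M p q (Σ_{1 ≤ k < p − q} L_k)`. -/
theorem shadowHall_of_layers (p q : ℕ) (F : ℕ → ℕ)
    (hF : ∀ u : ℕ, ∀ X ⊆ gr M, M.eRk (X : Set α) ≤ (u : ℕ∞) → X.card ≤ F u) :
    ShadowHall M p q (∑ k ∈ Finset.Ico 1 (p - q), layerProd (gr M).card q F k) := by
  intro 𝒜 h𝒜
  have h𝒜l : 𝒜 ⊆ levelSet M q := h𝒜.trans (Uq_subset_levelSet p q)
  have hsum : ∑ k ∈ Finset.Ico 1 (p - q), layerProd (gr M).card q F k * (𝒜.card : ℚ) ≤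
      ∑ k ∈ Finset.Ico 1 (p - q), ((shadowLevel M (q + k) 𝒜).card : ℚ) :=
    Finset.sum_le_sum (fun k _ => layerProd_mul_card_le_shadowLevel q F hF 𝒜 h𝒜l k)
  have hre : ∑ k ∈ Finset.Ico 1 (p - q), ((shadowLevel M (q + k) 𝒜).card : ℚ) =
      ∑ u ∈ Finset.Ioo q p, ((shadowLevel M u 𝒜).card : ℚ) := by
    rw [Finset.sum_Ico_eq_sum_range]
    rw [show Finset.Ioo q p = Finset.image (fun k => q + 1 + k) (Finset.range (p - q - 1)) from ?_]
    · rw [Finset.sum_image (fun a _ b _ h => by omega)]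
      apply Finset.sum_congr rfl
      intro k _
      rw [show q + (1 + k) = q + 1 + k by ring]
    · ext u
      rw [Finset.mem_Ioo, Finset.mem_image]
      constructor
      · intro hu
        exact ⟨u - q - 1, by rw [Finset.mem_range]; omega, by omega⟩
      · rintro ⟨k, hk, rfl⟩
        rw [Finset.mem_range] at hk
        omega
  have hle : ∑ u ∈ Finset.Ioo q p, ((shadowLevel M u 𝒜).card : ℚ) ≤ ((shadow M p q 𝒜).card : ℚ) := by
    exact_mod_cast sum_shadowLevel_card_le_shadow p q 𝒜
  rw [Finset.sum_mul]
  exact hsum.trans (hre ▸ hle)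

/-- Monotonicity of `ShadowHall` in the constant. -/
theorem shadowHall_mono {p q : ℕ} {c c' : ℚ} (hc : c' ≤ c) (h : ShadowHall M p q c) : ShadowHall M p q c' := by
  intro 𝒜 h𝒜
  have := h 𝒜 h𝒜
  have h0 : (0 : ℚ) ≤ (𝒜.card : ℚ) := by positivity
  nlinarith

end PercRepro.Shadow
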